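import Literature.AnabelianGeometry.SemiGraphs.TreeSystemClosedBaseWalkTransport
import Literature.AnabelianGeometry.SemiGraphs.SubdivisionGeodesicCoverNodes
import Literature.AnabelianGeometry.SemiGraphs.TemperedFixedBranchAtHostEventually
import Literature.AnabelianGeometry.SemiGraphs.TemperedCentralizerEscapeTwoBaseEdges
import HarnessLib

/-!
# [SemiAnbd] Thm 3.7 (iii) / Cor 3.9 (R3c) at ANY valence on a TREE-shaped `𝔾` with topologically cyclic
# edge groups: every fixed compatible pair of an edge piece is CONFINED over that edge (proof-only)

Mochizuki, *Semi-graphs of anabelioids*, Publ. RIMS **42** (2006), §3 Theorem 3.7 (iii), proof p. 41,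
third paragraph, with the author's *Comments* (2020) (6)(b); Corollary 3.9, proof p. 43 l. 13 (the
cell's step (R3c), FACT-LIST rows F-2772 `EdgeLikeCentralizerAt` / F-2773 `EdgeLikeCentralizer`)
[cite: MochizukiSemiAnbd2006, Thm 3.7(iii) p.41].

PROOF-ONLY (cell abc-iut, block F, seat abc-iut-f-175 gen 3; brick (C) of «CONFINED@TOP-CYCLIC-TREES»;
no definition, no named fact).  At the canonical tower of a countable `𝒢` satisfying the hypotheses of
Thm. 3.7 whose underlying semi-graph has ACYCLIC barycentric subdivision and ALL of whose edge groups are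
topologically cyclic: let `C ≠ 1` be a subgroup of `π₁^temp(𝒢)` fixing, at every level, the edge of a
branch over `b₀` at a vertex over `v₀` and of a branch over `b₀'` at a vertex over `u₀` (`b₀`, `b₀'` the
two branches of the base edge `e₀` — e.g. `C` an open piece of the edge-like subgroup of `e₀`).  Then for
ANY two compatible `C`-fixed vertex systems `x`, `x'` every branch on every level geodesic `[x_k, x'_k]`
lies over `e₀` (`confined_of_topCyclic_of_isAcyclic`).  Proof: a foreign base edge `ε` on `[x_k, x'_k]`
persists to all higher levels (abc-iut-f-172 gen 5, `exists_branch_over_geodesic_of_le`); the base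
geodesic from `v₀` to `ε` leaves `e₀` through a FIXED base branch `b₁` at `v₀` (or at `u₀`), which every
`C`-fixed tree path from a vertex over `v₀` to a branch over `ε` must cover
(`exists_mem_support_map_eq_of_isPath`); brick (B) (`exists_fixed_branch_of_closed_baseWalk`) transports
that `C`-fixed branch over `b₁` back to the host vertex carrying the `C`-fixed branch over `b₀` — at every
level, against abc-iut-w6-d062's estrangement in depth at the pair `(b₀, b₁)`
(`eventually_no_fixed_branch_over_ne_at_host`, abc-iut-f-172 gen 5).  With
`mem_verticial_of_centralizer_of_confined` this places the centraliser of `C` in each verticial host (sequel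
file).

Honest framing: one instance class; the ∀-closures F-2773 / F-1732 are NOT claimed; nothing here bears on
[IUTchIII] Cor. 3.12; typed ≠ proved elsewhere.
-/

namespace Literature.AnabelianGeometry.SemiGraphs

open CategoryTheory Topology

universe u


namespace ProfiniteSemiGraph

variable (𝒢 : ProfiniteSemiGraph.{u}) (h37 : 𝒢.Thm37Hypotheses)

/-- **Transport of a persistent foreign branch back to a vertex over `v₀`.**  At the canonical tower
(tree-shaped `𝔾`, topologically cyclic edge groups), let `Q` be the base geodesic from the point of `v₀` to
the point of a base edge `ε`, with first branch `b₁` (at `v₀`).  If a `C`-fixed path of `𝔾̃_j` from a vertex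
`a'` over `v₀` to a vertex `y'` carries a branch over `ε`, then `C` fixes the edge of a branch AT `a'` over
`b₁` (cover the geodesic `Q` by the image of the path, then brick (B)).
[cite: MochizukiSemiAnbd2006, Thm 3.7(iii) p.41] -/
theorem exists_fixed_branch_at_start_of_branch_over (hbase : 𝒢.graph.subdivision.IsAcyclic)
    (hcyc : ∀ e : 𝒢.graph.Edge, ∃ t₀ : 𝒢.Ge e, (Subgroup.zpowers t₀).topologicalClosure = ⊤)
    (C : Subgroup (𝒢.temperedPiChart h37.toProp36Hypotheses).G) {v₀ : 𝒢.graph.Vertex}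
    {ε : 𝒢.graph.Edge} (Q : 𝒢.graph.subdivision.Walk (Sum.inl v₀) (Sum.inr (Sum.inl ε))) (hQ : Q.IsPath)
    {b₁ : 𝒢.graph.Branch} (hQ₁ : Q.getVert 1 = Sum.inr (Sum.inr b₁)) (j : ℕ)
    {a' y' : ((𝒢.galoisLevelData h37.toProp36Hypotheses).tree j).Vertex}
    (ha' : ((𝒢.galoisLevelData h37.toProp36Hypotheses).treeProj j).vertexMap a' = v₀)
    (r : ((𝒢.galoisLevelData h37.toProp36Hypotheses).tree j).subdivision.Walk (Sum.inl a') (Sum.inl y'))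
    (hr : r.IsPath)
    (hrfix : ∀ z ∈ r.support, ∀ g ∈ C, SemiGraph.nodeMap
      ((𝒢.galoisLevelData h37.toProp36Hypotheses).treeAct h37.toProp36Hypotheses.isCountable j g) z = z)
    {β' : ((𝒢.galoisLevelData h37.toProp36Hypotheses).tree j).Branch}
    (hβ' : (Sum.inr (Sum.inr β') : ((𝒢.galoisLevelData h37.toProp36Hypotheses).tree j).Node) ∈ r.support)
    (hβ'ε : ((𝒢.galoisLevelData h37.toProp36Hypotheses).treeProj j).edgeMap
      (((𝒢.galoisLevelData h37.toProp36Hypotheses).tree j).edgeOf β') = ε) :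
    ∃ α : ((𝒢.galoisLevelData h37.toProp36Hypotheses).tree j).Branch,
      ((𝒢.galoisLevelData h37.toProp36Hypotheses).tree j).abuts α = some a' ∧
      ((𝒢.galoisLevelData h37.toProp36Hypotheses).treeProj j).branchMap α = b₁ ∧
      ∀ g ∈ C, ((𝒢.galoisLevelData h37.toProp36Hypotheses).treeAct h37.toProp36Hypotheses.isCountable j g).hom.edgeMap
          (((𝒢.galoisLevelData h37.toProp36Hypotheses).tree j).edgeOf α) =
        ((𝒢.galoisLevelData h37.toProp36Hypotheses).tree j).edgeOf α := by
  classical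
  let D := 𝒢.galoisLevelData h37.toProp36Hypotheses
  let hc := h37.toProp36Hypotheses.isCountable
  obtain ⟨P₀⟩ := GaloisLevelData.nonempty_pointSeq h37.toProp36Hypotheses v₀
  -- the base branch `b₁` abuts to `v₀`
  have hQlen : 0 < Q.length := by
    rcases Nat.eq_zero_or_pos Q.length with h | h
    · exact absurd (SimpleGraph.Walk.eq_of_length_eq_zero h) (by simp)
    · exact h
  have hb₁v₀ : 𝒢.graph.abuts b₁ = some v₀ := by
    have h := Q.adj_getVert_succ (i := 0) hQlen
    rw [SimpleGraph.Walk.getVert_zero, Nat.zero_add, hQ₁] at h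
    obtain ⟨b, hb, hbb⟩ := (𝒢.graph.subdivision_adj_inl_iff v₀ _).mp h
    have : b = b₁ := by simpa using hbb.symm
    exact this ▸ hb
  -- the fixed edge of a fixed branch-point on `r`
  have hfixE : ∀ β : (D.tree j).Branch, (Sum.inr (Sum.inr β) : (D.tree j).Node) ∈ r.support →
      ∀ g ∈ C, (D.treeAct hc j g).hom.edgeMap ((D.tree j).edgeOf β) = (D.tree j).edgeOf β := by
    intro β hβ g hg
    have h := hrfix _ hβ g hg
    simp only [SemiGraph.nodeMap_inr_inr, Sum.inr.injEq] at h
    rw [← (D.treeAct hc j g).hom.edgeOf_branchMap β, h]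
  -- the edge-point of `β'` lies on `r`; cut `r` there
  obtain ⟨hη, -⟩ := SemiGraph.edge_and_vertex_mem_support_of_branch_mem_support r hr hβ' (by simp)
  let r' := r.takeUntil _ hη
  have hr' : r'.IsPath := hr.takeUntil hη
  have hr's : ∀ z ∈ r'.support, z ∈ r.support := fun z hz => r.support_takeUntil_subset_support hη hz
  -- the base geodesic `Q` is covered by the image of `r'`: a branch `β₁` over `b₁` on `r'`
  let Φ : (D.tree j).subdivision →g 𝒢.graph.subdivision :=
    ⟨Sum.map (D.treeProj j).vertexMap (Sum.map (D.treeProj j).edgeMap (D.treeProj j).branchMap),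
      fun h => SemiGraph.subdivision_adj_map (D.treeProj j) h⟩
  have hΦa : Φ (Sum.inl a') = Sum.inl v₀ := by
    change Sum.inl ((D.treeProj j).vertexMap a') = Sum.inl v₀; rw [ha']
  have hΦη : Φ (Sum.inr (Sum.inl ((D.tree j).edgeOf β'))) = Sum.inr (Sum.inl ε) := by
    change Sum.inr (Sum.inl ((D.treeProj j).edgeMap ((D.tree j).edgeOf β'))) = Sum.inr (Sum.inl ε)
    rw [hβ'ε]
  have hb₁Q : (Sum.inr (Sum.inr b₁) : 𝒢.graph.Node) ∈ Q.support := hQ₁ ▸ Q.getVert_mem_support 1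
  obtain ⟨z, hz, hzb⟩ := SemiGraph.exists_mem_support_map_eq_of_isPath hbase Φ r' hΦa hΦη Q hQ hb₁Q
  obtain ⟨β₁, rfl, hβ₁b⟩ : ∃ β₁ : (D.tree j).Branch, z = Sum.inr (Sum.inr β₁) ∧
      (D.treeProj j).branchMap β₁ = b₁ := by
    rcases z with t | e | β₁
    · exact absurd hzb (by simp [Φ])
    · exact absurd hzb (by simp [Φ])
    · exact ⟨β₁, rfl, by simpa [Φ] using hzb⟩
  -- `β₁` is interior on `r'`, so it abuts to a vertex `t` on `r'`, over `v₀`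
  obtain ⟨-, t, hβ₁t, htr'⟩ :=
    SemiGraph.edge_and_vertex_mem_support_of_branch_mem_support r' hr' hz (by simp)
  have htv₀ : (D.treeProj j).vertexMap t = v₀ := by
    have h := (D.treeProj j).abuts_branchMap β₁ t hβ₁t
    rw [hβ₁b, hb₁v₀] at h
    exact (Option.some.inj h).symm
  -- cut at `t`: a `C`-fixed path from `a'` to `t`, both over `v₀`, and brick (B)
  let r'' := r'.takeUntil _ htr'
  obtain ⟨α, hαa, hαb, hαfix⟩ := D.exists_fixed_branch_of_closed_baseWalk hc j C hbase hcyc P₀ ha' htv₀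
    r'' (hr'.takeUntil htr') (fun z hz => hrfix z (hr's z (r'.support_takeUntil_subset_support htr' hz)))
    β₁ hβ₁t (hfixE β₁ (hr's _ hz))
  exact ⟨α, hαa, hαb.trans hβ₁b, hαfix⟩

/-- **One-sided contradiction.**  With `v₀`, `b₀` (a base branch at `v₀`) and, at every level, a vertex `a_j`
over `v₀` carrying a branch over `b₀` with `C`-fixed edge (`C ≠ 1`): if the base geodesic `Q` from the point
of `v₀` to the point of a base edge `ε` STARTS with a branch `b₁ ≠ b₀`, then no level geodesic of a compatible
`C`-fixed pair carries a branch over `ε`.  (Persistence `exists_branch_over_geodesic_of_le`; transport to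
`a_j` by `exists_fixed_branch_at_start_of_branch_over`; estrangement in depth at `(b₀, b₁)`,
`eventually_no_fixed_branch_over_ne_at_host`.) [cite: MochizukiSemiAnbd2006, Thm 3.7(iii) p.41] -/
theorem false_of_branch_over_of_firstBranch_ne (hbase : 𝒢.graph.subdivision.IsAcyclic)
    (hcyc : ∀ e : 𝒢.graph.Edge, ∃ t₀ : 𝒢.Ge e, (Subgroup.zpowers t₀).topologicalClosure = ⊤)
    (C : Subgroup (𝒢.temperedPiChart h37.toProp36Hypotheses).G) (hC : C ≠ ⊥)
    {v₀ : 𝒢.graph.Vertex} {b₀ : 𝒢.graph.Branch} (hb₀ : 𝒢.graph.abuts b₀ = some v₀)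
    (hδ : ∀ j, ∃ (a : ((𝒢.galoisLevelData h37.toProp36Hypotheses).tree j).Vertex)
      (δ : ((𝒢.galoisLevelData h37.toProp36Hypotheses).tree j).Branch),
      ((𝒢.galoisLevelData h37.toProp36Hypotheses).treeProj j).vertexMap a = v₀ ∧
      ((𝒢.galoisLevelData h37.toProp36Hypotheses).tree j).abuts δ = some a ∧
      ((𝒢.galoisLevelData h37.toProp36Hypotheses).treeProj j).branchMap δ = b₀ ∧
      ∀ g ∈ C, ((𝒢.galoisLevelData h37.toProp36Hypotheses).treeAct h37.toProp36Hypotheses.isCountable j g).hom.edgeMap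
          (((𝒢.galoisLevelData h37.toProp36Hypotheses).tree j).edgeOf δ) =
        ((𝒢.galoisLevelData h37.toProp36Hypotheses).tree j).edgeOf δ)
    (x x' : ∀ j, ((𝒢.galoisLevelData h37.toProp36Hypotheses).tree j).Vertex)
    (hx : ∀ ⦃i j : ℕ⦄ (hij : i ≤ j),
      ((𝒢.galoisLevelData h37.toProp36Hypotheses).treeTrans hij).vertexMap (x j) = x i)
    (hx' : ∀ ⦃i j : ℕ⦄ (hij : i ≤ j),
      ((𝒢.galoisLevelData h37.toProp36Hypotheses).treeTrans hij).vertexMap (x' j) = x' i)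
    (hfx : ∀ g ∈ C, ∀ j, ((𝒢.galoisLevelData h37.toProp36Hypotheses).treeAct h37.toProp36Hypotheses.isCountable j g).hom.vertexMap
      (x j) = x j)
    (hfx' : ∀ g ∈ C, ∀ j, ((𝒢.galoisLevelData h37.toProp36Hypotheses).treeAct h37.toProp36Hypotheses.isCountable j g).hom.vertexMap
      (x' j) = x' j)
    {ε : 𝒢.graph.Edge} (Q : 𝒢.graph.subdivision.Walk (Sum.inl v₀) (Sum.inr (Sum.inl ε))) (hQ : Q.IsPath)
    {b₁ : 𝒢.graph.Branch} (hQ₁ : Q.getVert 1 = Sum.inr (Sum.inr b₁)) (hb₁ : b₁ ≠ b₀) {k : ℕ}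
    (p : ((𝒢.galoisLevelData h37.toProp36Hypotheses).tree k).subdivision.Walk (Sum.inl (x k)) (Sum.inl (x' k)))
    (hp : p.IsPath) {β : ((𝒢.galoisLevelData h37.toProp36Hypotheses).tree k).Branch}
    (hβ : (Sum.inr (Sum.inr β) : ((𝒢.galoisLevelData h37.toProp36Hypotheses).tree k).Node) ∈ p.support)
    (hβε : ((𝒢.galoisLevelData h37.toProp36Hypotheses).treeProj k).edgeMap
      (((𝒢.galoisLevelData h37.toProp36Hypotheses).tree k).edgeOf β) = ε) : False := by
  classical
  let D := 𝒢.galoisLevelData h37.toProp36Hypotheses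
  let hc := h37.toProp36Hypotheses.isCountable
  -- `b₁` abuts to `v₀`
  have hQlen : 0 < Q.length := by
    rcases Nat.eq_zero_or_pos Q.length with h | h
    · exact absurd (SimpleGraph.Walk.eq_of_length_eq_zero h) (by simp)
    · exact h
  have hb₁v₀ : 𝒢.graph.abuts b₁ = some v₀ := by
    have h := Q.adj_getVert_succ (i := 0) hQlen
    rw [SimpleGraph.Walk.getVert_zero, Nat.zero_add, hQ₁] at h
    obtain ⟨b, hb, hbb⟩ := (𝒢.graph.subdivision_adj_inl_iff v₀ _).mp h
    have : b = b₁ := by simpa using hbb.symm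
    exact this ▸ hb
  -- the host vertices `a_j` and their `C`-fixed branches `δ_j` over `b₀`
  choose a δ ha hδa hδb hδfix using hδ
  have hCa : ∀ j, ∀ g ∈ C, (D.treeAct hc j g).hom.vertexMap (a j) = a j := by
    intro j g hg
    have hbr : (D.treeAct hc j g).hom.branchMap (δ j) = δ j :=
      SemiGraph.branchMap_eq_of_over_aut (D.treeProj j) (D.treeAct hc j g) (D.treeAct_over hc j g) (δ j)
        (hδfix j g hg)
    have h := (D.treeAct hc j g).hom.abuts_branchMap (δ j) (a j) (hδa j)
    rw [hbr, hδa j] at h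
    exact (Option.some.inj h).symm
  -- at every level `j ≥ k`: a `C`-fixed branch over `b₁` at `a_j`
  have step : ∀ j, k ≤ j → ∃ α : (D.tree j).Branch, (D.tree j).abuts α = some (a j) ∧
      (D.treeProj j).branchMap α = b₁ ∧
      ∀ g ∈ C, (D.treeAct hc j g).hom.edgeMap ((D.tree j).edgeOf α) = (D.tree j).edgeOf α := by
    intro j hkj
    have hT := (D.isTree_tree j).isTree
    -- the level-`j` geodesic carries a branch over `ε`
    let q : (D.tree j).subdivision.Path (Sum.inl (x j)) (Sum.inl (x' j)) := (hT.connected _ _).some.toPath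
    obtain ⟨βj, hβj, hβjε⟩ := 𝒢.exists_branch_over_geodesic_of_le h37 x x' hx hx' hkj p hp q.1 hβ
    have hβjε' : (D.treeProj j).edgeMap ((D.tree j).edgeOf βj) = ε := hβjε.trans hβε
    -- the `C`-fixed geodesics from `a_j` to `x_j` and to `x'_j`
    let r₁ : (D.tree j).subdivision.Path (Sum.inl (a j)) (Sum.inl (x j)) := (hT.connected _ _).some.toPath
    let r₂ : (D.tree j).subdivision.Path (Sum.inl (a j)) (Sum.inl (x' j)) := (hT.connected _ _).some.toPath
    have hfixr : ∀ (y : (D.tree j).Vertex), (∀ g ∈ C, (D.treeAct hc j g).hom.vertexMap y = y) →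
        ∀ (r : (D.tree j).subdivision.Walk (Sum.inl (a j)) (Sum.inl y)), r.IsPath →
        ∀ z ∈ r.support, ∀ g ∈ C, SemiGraph.nodeMap (D.treeAct hc j g) z = z := by
      intro y hy r hr z hz g hg
      have h1 : SemiGraph.nodeMap (D.treeAct hc j g) (Sum.inl (a j)) = Sum.inl (a j) := by simp [hCa j g hg]
      have h2 : SemiGraph.nodeMap (D.treeAct hc j g) (Sum.inl y) = Sum.inl y := by simp [hy g hg]
      exact SemiGraph.nodeMap_eq_self_of_isPath hT.isAcyclic _ h1 h2 r hr z hz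
    -- `βj` lies on `r₁` or on `r₂`
    have hβ₁₂ : (Sum.inr (Sum.inr βj) : (D.tree j).Node) ∈ (r₁.1.reverse.append r₂.1).support :=
      SemiGraph.support_subset_support_of_isPath hT.isAcyclic _ q.1 q.2 hβj
    rw [SimpleGraph.Walk.mem_support_append_iff, SimpleGraph.Walk.support_reverse, List.mem_reverse] at hβ₁₂
    rcases hβ₁₂ with h | h
    · exact 𝒢.exists_fixed_branch_at_start_of_branch_over h37 hbase hcyc C Q hQ hQ₁ j (ha j) r₁.1 r₁.2
        (hfixr (x j) (fun g hg => hfx g hg j) r₁.1 r₁.2) h hβjε'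
    · exact 𝒢.exists_fixed_branch_at_start_of_branch_over h37 hbase hcyc C Q hQ hQ₁ j (ha j) r₂.1 r₂.2
        (hfixr (x' j) (fun g hg => hfx' g hg j) r₂.1 r₂.2) h hβjε'
  -- estrangement in depth at the host vertex, pair `(b₀, b₁)`
  obtain ⟨K, hK⟩ := 𝒢.eventually_no_fixed_branch_over_ne_at_host h37 C hC v₀ hb₀ hb₁v₀ (Ne.symm hb₁) a ha
    fun j => ⟨δ j, hδa j, hδb j, hδfix j⟩
  obtain ⟨α, hαa, hαb, hαfix⟩ := step (max k K) (le_max_left _ _)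
  exact hK (max k K) (le_max_right _ _) α hαa hαb hαfix

/-- **CONFINEMENT over `e₀`** (tree-shaped `𝔾`, topologically cyclic edge groups, any valence).  At the
canonical tower, let `b₀ ≠ b₀'` be the two branches of a base edge `e₀`, at `v₀` and at `u₀`, and let the
subgroup `C ≠ 1` fix, at every level, the edge of a branch over `b₀` at some vertex over `v₀` and the edge of
a branch over `b₀'` at some vertex over `u₀` (e.g. `C` an open piece of the edge-like subgroup of `e₀`, the two
branches of a `C`-fixed tree edge over `e₀`).  Then every branch on every level geodesic `[x_k, x'_k]` of ANY
compatible `C`-fixed pair `(x, x')` lies over `e₀`. [cite: MochizukiSemiAnbd2006, Thm 3.7(iii) p.41] -/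
theorem confined_of_topCyclic_of_isAcyclic (hbase : 𝒢.graph.subdivision.IsAcyclic)
    (hcyc : ∀ e : 𝒢.graph.Edge, ∃ t₀ : 𝒢.Ge e, (Subgroup.zpowers t₀).topologicalClosure = ⊤)
    (C : Subgroup (𝒢.temperedPiChart h37.toProp36Hypotheses).G) (hC : C ≠ ⊥)
    {v₀ u₀ : 𝒢.graph.Vertex} {b₀ b₀' : 𝒢.graph.Branch} (hb₀ : 𝒢.graph.abuts b₀ = some v₀)
    (hb₀' : 𝒢.graph.abuts b₀' = some u₀) (hbb : b₀ ≠ b₀') (he : 𝒢.graph.edgeOf b₀' = 𝒢.graph.edgeOf b₀)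
    (hδ : ∀ j, ∃ (a : ((𝒢.galoisLevelData h37.toProp36Hypotheses).tree j).Vertex)
      (δ : ((𝒢.galoisLevelData h37.toProp36Hypotheses).tree j).Branch),
      ((𝒢.galoisLevelData h37.toProp36Hypotheses).treeProj j).vertexMap a = v₀ ∧
      ((𝒢.galoisLevelData h37.toProp36Hypotheses).tree j).abuts δ = some a ∧
      ((𝒢.galoisLevelData h37.toProp36Hypotheses).treeProj j).branchMap δ = b₀ ∧
      ∀ g ∈ C, ((𝒢.galoisLevelData h37.toProp36Hypotheses).treeAct h37.toProp36Hypotheses.isCountable j g).hom.edgeMap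
          (((𝒢.galoisLevelData h37.toProp36Hypotheses).tree j).edgeOf δ) =
        ((𝒢.galoisLevelData h37.toProp36Hypotheses).tree j).edgeOf δ)
    (hδ' : ∀ j, ∃ (a : ((𝒢.galoisLevelData h37.toProp36Hypotheses).tree j).Vertex)
      (δ : ((𝒢.galoisLevelData h37.toProp36Hypotheses).tree j).Branch),
      ((𝒢.galoisLevelData h37.toProp36Hypotheses).treeProj j).vertexMap a = u₀ ∧
      ((𝒢.galoisLevelData h37.toProp36Hypotheses).tree j).abuts δ = some a ∧
      ((𝒢.galoisLevelData h37.toProp36Hypotheses).treeProj j).branchMap δ = b₀' ∧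
      ∀ g ∈ C, ((𝒢.galoisLevelData h37.toProp36Hypotheses).treeAct h37.toProp36Hypotheses.isCountable j g).hom.edgeMap
          (((𝒢.galoisLevelData h37.toProp36Hypotheses).tree j).edgeOf δ) =
        ((𝒢.galoisLevelData h37.toProp36Hypotheses).tree j).edgeOf δ)
    (x x' : ∀ j, ((𝒢.galoisLevelData h37.toProp36Hypotheses).tree j).Vertex)
    (hx : ∀ ⦃i j : ℕ⦄ (hij : i ≤ j),
      ((𝒢.galoisLevelData h37.toProp36Hypotheses).treeTrans hij).vertexMap (x j) = x i)
    (hx' : ∀ ⦃i j : ℕ⦄ (hij : i ≤ j),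
      ((𝒢.galoisLevelData h37.toProp36Hypotheses).treeTrans hij).vertexMap (x' j) = x' i)
    (hfx : ∀ g ∈ C, ∀ j, ((𝒢.galoisLevelData h37.toProp36Hypotheses).treeAct h37.toProp36Hypotheses.isCountable j g).hom.vertexMap
      (x j) = x j)
    (hfx' : ∀ g ∈ C, ∀ j, ((𝒢.galoisLevelData h37.toProp36Hypotheses).treeAct h37.toProp36Hypotheses.isCountable j g).hom.vertexMap
      (x' j) = x' j)
    (k : ℕ)
    (p : ((𝒢.galoisLevelData h37.toProp36Hypotheses).tree k).subdivision.Walk (Sum.inl (x k)) (Sum.inl (x' k)))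
    (hp : p.IsPath) (β : ((𝒢.galoisLevelData h37.toProp36Hypotheses).tree k).Branch)
    (hβ : (Sum.inr (Sum.inr β) : ((𝒢.galoisLevelData h37.toProp36Hypotheses).tree k).Node) ∈ p.support) :
    ((𝒢.galoisLevelData h37.toProp36Hypotheses).treeProj k).edgeMap
      (((𝒢.galoisLevelData h37.toProp36Hypotheses).tree k).edgeOf β) = 𝒢.graph.edgeOf b₀ := by
  classical
  by_contra hne
  set ε := ((𝒢.galoisLevelData h37.toProp36Hypotheses).treeProj k).edgeMap
      (((𝒢.galoisLevelData h37.toProp36Hypotheses).tree k).edgeOf β) with hε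
  -- the base geodesic `Q` from the point of `v₀` to the point of `ε`, and its first branch `b`
  let Q : 𝒢.graph.subdivision.Path (Sum.inl v₀) (Sum.inr (Sum.inl ε)) :=
    (h37.isConnected.connected (Sum.inl v₀) (Sum.inr (Sum.inl ε))).some.toPath
  have hinj := Q.2.getVert_injOn
  have hQlen : 0 < Q.1.length := by
    rcases Nat.eq_zero_or_pos Q.1.length with h | h
    · exact absurd (SimpleGraph.Walk.eq_of_length_eq_zero h) (by simp)
    · exact h
  have hend : Q.1.getVert Q.1.length = Sum.inr (Sum.inl ε) := Q.1.getVert_length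
  have h01 := Q.1.adj_getVert_succ (i := 0) hQlen
  rw [SimpleGraph.Walk.getVert_zero, Nat.zero_add] at h01
  obtain ⟨b, hbv₀, hQ₁⟩ := (𝒢.graph.subdivision_adj_inl_iff v₀ _).mp h01
  by_cases hbb₀ : b = b₀
  swap
  · -- `ε` on the far side of a branch `b ≠ b₀` at `v₀`
    exact 𝒢.false_of_branch_over_of_firstBranch_ne h37 hbase hcyc C hC hb₀ hδ x x' hx hx' hfx hfx' Q.1 Q.2
      hQ₁ hbb₀ p hp hβ hε.symm
  -- `ε` beyond `u₀`: the geodesic runs `v₀, b₀, e₀, b₀', u₀, b', …` with `b' ≠ b₀'`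
  subst hbb₀
  -- node 2 = the point of `e₀`
  have hlen2 : 2 ≤ Q.1.length := by
    by_contra h
    have h1 : Q.1.length = 1 := by omega
    rw [h1] at hend; rw [hend] at hQ₁; simp at hQ₁
  have h12 := Q.1.adj_getVert_succ (i := 1) (by omega)
  rw [hQ₁] at h12
  have hQ₂ : Q.1.getVert 2 = Sum.inr (Sum.inl (𝒢.graph.edgeOf b)) := by
    rcases (𝒢.graph.subdivision_adj_branch_iff b _).mp h12 with h | ⟨v, hv, h⟩
    · exact h
    · exfalso
      rw [hbv₀] at hv; cases hv
      have h0 : Q.1.getVert (1 + 1) = Q.1.getVert 0 := by rw [h, SimpleGraph.Walk.getVert_zero]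
      have := hinj (by simp; omega) (by simp) h0
      omega
  -- node 3 = the other branch `b₀'` of `e₀`
  have hlen3 : 3 ≤ Q.1.length := by
    by_contra h
    have h2 : Q.1.length = 2 := by omega
    rw [h2] at hend; rw [hend] at hQ₂
    exact hne (by simpa using hQ₂)
  have h23 := Q.1.adj_getVert_succ (i := 2) (by omega)
  rw [hQ₂] at h23
  obtain ⟨b'', hb''e, hQ₃⟩ := (𝒢.graph.subdivision_adj_edge_iff _ _).mp h23
  have hb''b : b'' ≠ b := by
    intro h
    rw [h] at hQ₃
    have h0 : Q.1.getVert (2 + 1) = Q.1.getVert 1 := by rw [hQ₃, hQ₁]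
    have := hinj (by simp; omega) (by simp; omega) h0
    omega
  have hb'' : b'' = b₀' := by
    obtain ⟨c₁, c₂, -, -, -, hall⟩ := 𝒢.graph.two_branches (𝒢.graph.edgeOf b)
    rcases hall b rfl with h₁ | h₁ <;> rcases hall b₀' he with h₂ | h₂ <;>
      rcases hall b'' hb''e with h₃ | h₃
    all_goals first
      | exact (hb''b (h₃.trans h₁.symm)).elim
      | exact (hbb (h₁.trans h₂.symm)).elim
      | exact h₃.trans h₂.symm
  rw [hb''] at hQ₃
  -- node 4 = the point of `u₀`
  have hlen4 : 4 ≤ Q.1.length := by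
    by_contra h
    have h3 : Q.1.length = 3 := by omega
    rw [h3] at hend; rw [hend] at hQ₃; simp at hQ₃
  have h34 := Q.1.adj_getVert_succ (i := 3) (by omega)
  rw [hQ₃] at h34
  have hQ₄ : Q.1.getVert 4 = Sum.inl u₀ := by
    rcases (𝒢.graph.subdivision_adj_branch_iff b₀' _).mp h34 with h | ⟨v, hv, h⟩
    · exfalso
      rw [he] at h
      have h0 : Q.1.getVert (3 + 1) = Q.1.getVert 2 := by rw [h, hQ₂]
      have := hinj (by simp; omega) (by simp; omega) h0
      omega
    · rw [hb₀'] at hv; cases hv; exact h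
  -- node 5 = a branch `b' ≠ b₀'` at `u₀`
  have hlen5 : 5 ≤ Q.1.length := by
    by_contra h
    have h4 : Q.1.length = 4 := by omega
    rw [h4] at hend; rw [hend] at hQ₄; simp at hQ₄
  have h45 := Q.1.adj_getVert_succ (i := 4) (by omega)
  rw [hQ₄] at h45
  obtain ⟨b', hb'u₀, hQ₅⟩ := (𝒢.graph.subdivision_adj_inl_iff u₀ _).mp h45
  have hb'b₀' : b' ≠ b₀' := by
    intro h
    rw [h] at hQ₅
    have h0 : Q.1.getVert (4 + 1) = Q.1.getVert 3 := by rw [hQ₅, hQ₃]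
    have := hinj (by simp; omega) (by simp; omega) h0
    omega
  -- the geodesic from the point of `u₀`
  let Q' : 𝒢.graph.subdivision.Walk (Sum.inl u₀) (Sum.inr (Sum.inl ε)) := (Q.1.drop 4).copy hQ₄ rfl
  have hQ' : Q'.IsPath := by
    refine SimpleGraph.Walk.IsPath.mk' ?_
    rw [SimpleGraph.Walk.support_copy, SimpleGraph.Walk.drop_support_eq_support_drop_min]
    exact Q.2.support_nodup.sublist (List.drop_sublist _ _)
  have hQ'₁ : Q'.getVert 1 = Sum.inr (Sum.inr b') := by
    rw [SimpleGraph.Walk.getVert_copy, SimpleGraph.Walk.drop_getVert]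
    exact hQ₅
  exact 𝒢.false_of_branch_over_of_firstBranch_ne h37 hbase hcyc C hC hb₀' hδ' x x' hx hx' hfx hfx' Q' hQ'
    hQ'₁ hb'b₀' p hp hβ hε.symm

end ProfiniteSemiGraph

end Literature.AnabelianGeometry.SemiGraphs
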